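import Mathlib
import HarnessLib
import Literature.Analysis.FluidPDE.SuitableWeak
import Literature.Analysis.FluidPDE.SelfSimilar
import Literature.Analysis.FluidPDE.LocalTypeI
import Literature.Analysis.FluidPDE.NSBoundedMildOseen
import Literature.Analysis.FluidPDE.SlabTypeICompactness

/-!
# Stub `stub_slabCompactness` for line decaying-ancient-bridge of crux RellichScar.ApexLocalisation

The ENGINE of the line: suitable weak solutions `(v_k, q_k)` on the backward slab
`(-∞, 0) × ℝ³` with weak gradients `G_k` and uniformly bounded Albritton–Barker quantity
`𝐈 ≤ I < ∞` subconverge in `L³(Q(0, R))` for every `R > 0` to a suitable weak solution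
`(u, p, H)` on the whole slab with `𝐈 ≤ 4 I`, and if the approximants blow up in
`L^∞(Q(0, R))` for every `R` along the subsequence then the origin is a backward singular point
of `u` (Albritton–Barker 2019, Lemma 2.2 + Prop. 2.3 + the lower semicontinuity of `A, C, D, E`
of §3, exhausted to the slab).

All the mathematics is in the Literature tree: the pressure normalisation to unit-ball mean zero
(`Literature/Analysis/FluidPDE/SlabPressureNormalization.lean`), A–B Lemma 2.2 on the expanding
balls `Q(0, 2ᵐ)` (`SlabSuitableCompactness.lean`), and the engine itself
(`Literature.Analysis.FluidPDE.slab_typeI_compactness`, `SlabTypeICompactness.lean`), of which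
this stub is the verbatim specialisation.
-/

-- the summit and its single sub-problem share the name (CONVENTIONS §1), as in every Theorems file
set_option linter.dupNamespace false

namespace Summit.NavierStokesRegularity.NavierStokesRegularity.Theorems.RellichScarApexLocalisation

open MeasureTheory Set Function Metric Filter Topology TopologicalSpace
open scoped ENNReal NNReal
open Literature.Analysis Literature.Analysis.FluidPDE

local notation "E³" => EuclideanSpace ℝ (Fin 3)

/-- **Engine of line decaying-ancient-bridge** (Albritton–Barker 2019, Lemma 2.2 + Prop. 2.3
exhausted to the slab): slab suitable weak solutions with weak gradients and `𝐈 ≤ I < ∞`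
subconverge in `L³(Q(0,R))`, `R > 0`, to a slab suitable weak solution `(u, p, H)` with
`𝐈 ≤ 4 I`; blow-up of the approximants in every `L^∞(Q(0,R))` makes the origin a backward
singular point of `u`.  This is `Literature.Analysis.FluidPDE.slab_typeI_compactness`. -/
theorem stub_slabCompactness :
    ∀ (I : ℝ≥0∞) (v : ℕ → ℝ → E³ → E³) (q : ℕ → ℝ → E³ → ℝ) (G : ℕ → ℝ → E³ → E³ →L[ℝ] E³),
      I < ⊤ →
      (∀ k, IsSuitableWeakSolutionOn (slab E³ (Iio 0) isOpen_Iio) 1 0 (v k) (q k)) →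
      (∀ k, HasWeakSpatialGradientOn (slab E³ (Iio 0) isOpen_Iio) (v k) (G k)) →
      (∀ k, typeIBound (Iio (0 : ℝ) ×ˢ univ) (v k) (q k) (G k) ≤ I) →
      ∃ (u : ℝ → E³ → E³) (p : ℝ → E³ → ℝ) (H : ℝ → E³ → E³ →L[ℝ] E³) (σ : ℕ → ℕ),
        StrictMono σ ∧
        IsSuitableWeakSolutionOn (slab E³ (Iio 0) isOpen_Iio) 1 0 u p ∧
        HasWeakSpatialGradientOn (slab E³ (Iio 0) isOpen_Iio) u H ∧
        typeIBound (Iio (0 : ℝ) ×ˢ univ) u p H ≤ 4 * I ∧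
        (∀ R : ℝ, 0 < R → Tendsto (fun j => eLpNorm (uncurry (v (σ j)) - uncurry u) 3
          (volume.restrict (parabolicCylinder R (0 : ℝ × E³)))) atTop (𝓝 0)) ∧
        ((∀ R : ℝ, 0 < R → limsup (fun j => eLpNorm (uncurry (v (σ j))) ⊤
            (volume.restrict (parabolicCylinder R (0 : ℝ × E³)))) atTop = ⊤) →
          IsBackwardSingularPoint u 0) := by
  exact slab_typeI_compactness

end Summit.NavierStokesRegularity.NavierStokesRegularity.Theorems.RellichScarApexLocalisation
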